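import Summits.KontsevichZagierPeriods.KontsevichZagierPeriods.Theorems.FermatIsogenyDeepWordSectorP05

/-! # `FermatIsogenyDeepWordSectorP06` — part 6/11 of the mechanical ≤400-line split of `DeepWordSector.lean` (sha256 5e8cd5c1c920648a…)
Source: decomp-kz lens-5 g22 DeepWordSector.lean v10 @5e8cd5c1 (the deep Beta-word sector node: bridge S ⟺ BetaWordTower ∧ WordSectorComplete, finite boxes, box ladder, shadow arithmetic, Chudnovsky levels; critic CLEARED g6-2/3/4/11/13/16/19); --supports stmt-KontsevichZagierPeriods-3898.
Split by census-1 g10 `gen/splitlean.py`: scopes re-opened with their `open`/`variable`/`set_option` context; mathematics and declaration order unchanged. -/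

namespace Summit.KontsevichZagierPeriods.FermatIsogeny.DeepTargets
open Literature.NumberTheory.Transcendental MeasureTheory
open Summit.KontsevichZagierPeriods.KontsevichZagierPeriods.Theses.FermatIsogeny (BetaLinearSector BetaProductSector FermatSectorComplete)

open Literature.NumberTheory.Transcendental MeasureTheory in
open Summit.KontsevichZagierPeriods.KontsevichZagierPeriods.Theses.FermatIsogeny (BetaLinearSector BetaProductSector FermatSectorComplete) in
open MeasureTheory Set in
open Literature.NumberTheory.Transcendental Literature.NumberTheory.Transcendental.KZ in
open Literature.ModelTheory.ExponentialFields (IsSemialgebraic isSemialgebraic_univ isSemialgebraic_setOf_eval_pos) in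
open MvPolynomial (aeval X C) in
/-- Transport of integrability between `S ⊆ ℝ` and `{x | x 0 ∈ S} ⊆ ℝ¹`. [folklore] -/
private theorem integrableOn_setOf_apply_mem_iff {g : ℝ → ℝ} {S : Set ℝ} :  -- Literature home of the Summits-side `integrableOn_comp_apply_zero_iff`
    IntegrableOn (fun x : Fin 1 → ℝ => g (x 0)) {x | x 0 ∈ S} ↔ IntegrableOn g S :=
  (volume_preserving_funUnique (Fin 1) ℝ).integrableOn_comp_preimage
    (MeasurableEquiv.funUnique (Fin 1) ℝ).measurableEmbedding

open Literature.NumberTheory.Transcendental MeasureTheory in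
open Summit.KontsevichZagierPeriods.KontsevichZagierPeriods.Theses.FermatIsogeny (BetaLinearSector BetaProductSector FermatSectorComplete) in
open MeasureTheory Set in
open Literature.NumberTheory.Transcendental Literature.NumberTheory.Transcendental.KZ in
open Literature.ModelTheory.ExponentialFields (IsSemialgebraic isSemialgebraic_univ isSemialgebraic_setOf_eval_pos) in
open MvPolynomial (aeval X C) in
/-- `[0,1] ∖ (0,1) ⊆ ℝ¹` is null (two points). [folklore] -/
private theorem volume_setOf_Icc_diff_Ioo :
    volume ({x : Fin 1 → ℝ | x 0 ∈ Set.Icc (0:ℝ) 1} \ {x | x 0 ∈ Set.Ioo (0:ℝ) 1}) = 0 := by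
  refine measure_mono_null (fun x hx => ?_)
    (measure_union_null (BallPeeling.volume_setOf_apply_eq_const 1 (0 : Fin 1) 0)
      (BallPeeling.volume_setOf_apply_eq_const 1 (0 : Fin 1) 1))
  simp only [mem_sdiff, mem_setOf_eq, mem_Icc, mem_Ioo, not_and, not_lt] at hx
  simp only [mem_union, mem_setOf_eq]
  obtain ⟨⟨h1, h2⟩, h3⟩ := hx
  rcases h1.lt_or_eq with h1 | h1
  · exact Or.inr (le_antisymm h2 (h3 h1))
  · exact Or.inl h1.symm

open Literature.NumberTheory.Transcendental MeasureTheory in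
open Summit.KontsevichZagierPeriods.KontsevichZagierPeriods.Theses.FermatIsogeny (BetaLinearSector BetaProductSector FermatSectorComplete) in
open MeasureTheory Set in
open Literature.NumberTheory.Transcendental Literature.NumberTheory.Transcendental.KZ in
open Literature.ModelTheory.ExponentialFields (IsSemialgebraic isSemialgebraic_univ isSemialgebraic_setOf_eval_pos) in
open MvPolynomial (aeval X C) in
/-- `[0,1] ⊆ ℝ¹` (first-coordinate spelling) is `ℚ`-semialgebraic. [folklore] -/
private theorem isSemialgebraic_setOf_apply_mem_Icc :
    IsSemialgebraic ℚ {x : Fin 1 → ℝ | x 0 ∈ Set.Icc (0:ℝ) 1} := by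
  have h1 := Literature.ModelTheory.ExponentialFields.isSemialgebraic_setOf_eval_le (k := ℚ) (R := ℝ)
    (0 : MvPolynomial (Fin 1) ℚ) (X 0)
  have h2 := Literature.ModelTheory.ExponentialFields.isSemialgebraic_setOf_eval_le (k := ℚ) (R := ℝ)
    (X 0 : MvPolynomial (Fin 1) ℚ) 1
  have h := h1.inter h2
  simp only [map_zero, map_one, MvPolynomial.aeval_X] at h
  have hset : {x : Fin 1 → ℝ | x 0 ∈ Set.Icc (0:ℝ) 1} = {x : Fin 1 → ℝ | 0 ≤ x 0} ∩ {x | x 0 ≤ 1} := by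
    ext x
    simp
  rw [hset]
  exact h

open Literature.NumberTheory.Transcendental MeasureTheory in
open Summit.KontsevichZagierPeriods.KontsevichZagierPeriods.Theses.FermatIsogeny (BetaLinearSector BetaProductSector FermatSectorComplete) in
open MeasureTheory Set in
open Literature.NumberTheory.Transcendental Literature.NumberTheory.Transcendental.KZ in
open Literature.ModelTheory.ExponentialFields (IsSemialgebraic isSemialgebraic_univ isSemialgebraic_setOf_eval_pos) in
open MvPolynomial (aeval X C) in
/-- Two-factor Euler–Mellin monomials `c · (x 0)^e · (1 − x 0)^{e'}` (`c, e, e' ∈ ℚ`) are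
`ℚ`-semialgebraic on `(0,1) ⊆ ℝ¹` (`KZ.isSemialgebraicFunOn_mellinIntegrand`). [folklore] -/
private theorem isSemialgebraicFunOn_const_mul_rpow_mul_rpow (c e e' : ℚ) :
    IsSemialgebraicFunOn ℚ {x : Fin 1 → ℝ | x 0 ∈ Set.Ioo (0:ℝ) 1}
      (fun x => (c : ℝ) * ((x 0) ^ ((e : ℚ) : ℝ) * (1 - x 0) ^ ((e' : ℚ) : ℝ))) := by
  refine (isSemialgebraicFunOn_mellinIntegrand BallPeeling.isSemialgebraic_posIoo
    ![MvPolynomial.X 0, 1 - MvPolynomial.X 0] ![e, e'] c (fun x hx k => ?_)).congr fun x _ => ?_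
  · have hx' : 0 < x 0 ∧ x 0 < 1 := hx
    fin_cases k
    · simpa using hx'.1
    · simp only [Fin.mk_one, Matrix.cons_val_one, Matrix.cons_val_fin_one, map_sub, map_one,
        MvPolynomial.aeval_X, sub_pos]
      exact hx'.2
  · simp [mellinIntegrand_apply, Fin.prod_univ_two]

open Literature.NumberTheory.Transcendental MeasureTheory in
open Summit.KontsevichZagierPeriods.KontsevichZagierPeriods.Theses.FermatIsogeny (BetaLinearSector BetaProductSector FermatSectorComplete) in
open MeasureTheory Set in
open Literature.NumberTheory.Transcendental Literature.NumberTheory.Transcendental.KZ in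
open Literature.ModelTheory.ExponentialFields (IsSemialgebraic isSemialgebraic_univ isSemialgebraic_setOf_eval_pos) in
open MvPolynomial (aeval X C) in
/-- **Extension by rational endpoint values**: a function on `ℝ¹` which is `ℚ`-semialgebraic on
`(0,1)` and takes rational values `c₀`, `c₁` at `x 0 = 0`, `x 0 = 1` is `ℚ`-semialgebraic on
`[0,1]` (the graph gains two rational points). [folklore] -/
private theorem isSemialgebraicFunOn_Icc_of_Ioo {f : (Fin 1 → ℝ) → ℝ}
    (hf : IsSemialgebraicFunOn ℚ {x : Fin 1 → ℝ | x 0 ∈ Set.Ioo (0:ℝ) 1} f) (c₀ c₁ : ℚ)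
    (h0 : ∀ x : Fin 1 → ℝ, x 0 = 0 → f x = c₀) (h1 : ∀ x : Fin 1 → ℝ, x 0 = 1 → f x = c₁) :
    IsSemialgebraicFunOn ℚ {x : Fin 1 → ℝ | x 0 ∈ Set.Icc (0:ℝ) 1} f := by
  rw [isSemialgebraicFunOn_iff] at hf ⊢
  have hpt : ∀ (u c : ℚ), IsSemialgebraic ℚ
      {z : Fin (1 + 1) → ℝ | (Fin.init z : Fin 1 → ℝ) 0 = (u : ℝ) ∧ z (Fin.last 1) = (c : ℝ)} := by
    intro u c
    have h1 := Literature.ModelTheory.ExponentialFields.isSemialgebraic_setOf_eval_eq_zero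
      (k := ℚ) (R := ℝ) (MvPolynomial.X (Fin.castSucc (0 : Fin 1)) - MvPolynomial.C u :
        MvPolynomial (Fin (1 + 1)) ℚ)
    have h2 := Literature.ModelTheory.ExponentialFields.isSemialgebraic_setOf_eval_eq_zero
      (k := ℚ) (R := ℝ) (MvPolynomial.X (Fin.last 1) - MvPolynomial.C c : MvPolynomial (Fin (1 + 1)) ℚ)
    convert h1.inter h2 using 1
    ext z
    simp only [mem_setOf_eq, mem_inter_iff, map_sub, MvPolynomial.aeval_X, MvPolynomial.aeval_C,
      eq_ratCast, sub_eq_zero, Fin.init]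
  have hset : {z : Fin (1 + 1) → ℝ | (Fin.init z : Fin 1 → ℝ) ∈ {x : Fin 1 → ℝ | x 0 ∈ Set.Icc (0:ℝ) 1} ∧
        z (Fin.last 1) = f (Fin.init z)} =
      {z | (Fin.init z : Fin 1 → ℝ) ∈ {x : Fin 1 → ℝ | x 0 ∈ Set.Ioo (0:ℝ) 1} ∧
        z (Fin.last 1) = f (Fin.init z)} ∪
      {z | (Fin.init z : Fin 1 → ℝ) 0 = ((0:ℚ):ℝ) ∧ z (Fin.last 1) = (c₀:ℝ)} ∪
      {z | (Fin.init z : Fin 1 → ℝ) 0 = ((1:ℚ):ℝ) ∧ z (Fin.last 1) = (c₁:ℝ)} := by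
    ext z
    simp only [mem_union, mem_setOf_eq, mem_Icc, mem_Ioo, Rat.cast_zero, Rat.cast_one]
    constructor
    · rintro ⟨⟨hl, hr⟩, hz⟩
      rcases hl.lt_or_eq with hl | hl
      · rcases hr.lt_or_eq with hr | hr
        · exact Or.inl (Or.inl ⟨⟨hl, hr⟩, hz⟩)
        · exact Or.inr ⟨hr, by rw [hz, h1 _ hr]⟩
      · exact Or.inl (Or.inr ⟨hl.symm, by rw [hz, h0 _ hl.symm]⟩)
    · rintro ((⟨⟨hl, hr⟩, hz⟩ | ⟨hl, hz⟩) | ⟨hl, hz⟩)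
      · exact ⟨⟨hl.le, hr.le⟩, hz⟩
      · exact ⟨⟨hl.ge, by rw [hl]; exact zero_le_one⟩, by rw [hz, h0 _ hl]⟩
      · exact ⟨⟨by rw [hl]; exact zero_le_one, hl.le⟩, by rw [hz, h1 _ hl]⟩
  rw [hset]
  exact (hf.union (hpt 0 c₀)).union (hpt 1 c₁)

open Literature.NumberTheory.Transcendental MeasureTheory in
open Summit.KontsevichZagierPeriods.KontsevichZagierPeriods.Theses.FermatIsogeny (BetaLinearSector BetaProductSector FermatSectorComplete) in
open MeasureTheory Set in
open Literature.NumberTheory.Transcendental Literature.NumberTheory.Transcendental.KZ in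
open Literature.ModelTheory.ExponentialFields (IsSemialgebraic isSemialgebraic_univ isSemialgebraic_setOf_eval_pos) in
open MvPolynomial (aeval X C) in
/-- The derivative of `t^a (1-t)^b` inside `(0,1)`. [folklore] -/
private theorem hasDerivAt_rpow_mul_one_sub_rpow {a b t : ℝ} (ht : t ∈ Set.Ioo (0:ℝ) 1) :
    HasDerivAt (fun s : ℝ => s ^ a * (1 - s) ^ b)
      (a * t ^ (a - 1) * (1 - t) ^ b + t ^ a * (-1 * b * (1 - t) ^ (b - 1))) t := by
  have h1 : HasDerivAt (fun s : ℝ => s ^ a) (a * t ^ (a - 1)) t :=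
    Real.hasDerivAt_rpow_const (Or.inl ht.1.ne')
  have h2 : HasDerivAt (fun s : ℝ => (1 - s) ^ b) (-1 * b * (1 - t) ^ (b - 1)) t := by
    have h := ((hasDerivAt_id t).const_sub 1).rpow_const (p := b)
      (Or.inl (by simp only [id]; linarith [ht.2]))
    simpa using h
  exact h1.mul h2

open Literature.NumberTheory.Transcendental MeasureTheory in
open Summit.KontsevichZagierPeriods.KontsevichZagierPeriods.Theses.FermatIsogeny (BetaLinearSector BetaProductSector FermatSectorComplete) in
open MeasureTheory Set in
open Literature.NumberTheory.Transcendental Literature.NumberTheory.Transcendental.KZ in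
open Literature.ModelTheory.ExponentialFields (IsSemialgebraic isSemialgebraic_univ isSemialgebraic_setOf_eval_pos) in
open MvPolynomial (aeval X C) in
/-- **`[(0,1), (a+b) t^{a-1}(1-t)^{b}] ∼ [(0,1), b t^{a-1}(1-t)^{b-1}]`** for `0 < a, b ∈ ℚ` and
representations pinned by their integrands on `(0,1)`: ONE Newton–Leibniz move from the point
`ℝ⁰` (band `[0,1]`, primitive `F(t) = t^a (1-t)^b`, `F(0) = F(1) = 0`, so
`[[0,1], F'] − [pt, 0]` is a move and `[[0,1], F'] ∈ relations`), the null boundary `{0,1}`, and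
ONE integrand-additivity move on `(0,1)`:
`(a+b) t^{a-1}(1-t)^b = F'(t) + b t^{a-1}(1-t)^{b-1}` with `F' = a t^{a-1}(1-t)^b − b t^a(1-t)^{b-1}`.
Value identity: `(a+b) B(a,b+1) = b B(a,b)`. (cite AndrewsAskeyRoy1999, §1.1) -/
private theorem betaTranslation_equivalent (a b : ℚ) (ha : 0 < a) (hb : 0 < b) (ρ ρ' : IntegralRep 1)
    (hρd : ρ.domain = {x | x 0 ∈ Set.Ioo (0:ℝ) 1})
    (hρi : Set.EqOn ρ.integrand (fun x => ((a:ℝ) + b) * ((x 0) ^ ((a:ℝ) - 1) * (1 - x 0) ^ (b:ℝ)))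
      ρ.domain)
    (hρ'd : ρ'.domain = {x | x 0 ∈ Set.Ioo (0:ℝ) 1})
    (hρ'i : Set.EqOn ρ'.integrand (fun x => (b:ℝ) * ((x 0) ^ ((a:ℝ) - 1) * (1 - x 0) ^ ((b:ℝ) - 1)))
      ρ'.domain) :
    Equivalent ρ ρ' := by
  have ha' : (a:ℝ) ≠ 0 := by exact_mod_cast ha.ne'
  have hb' : (b:ℝ) ≠ 0 := by exact_mod_cast hb.ne'
  have haR : (0:ℝ) < a := by exact_mod_cast ha
  have hbR : (0:ℝ) < b := by exact_mod_cast hb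
  set g : ℝ → ℝ := fun t => if t ∈ Set.Ioo (0:ℝ) 1 then
      (a:ℝ) * t ^ ((a:ℝ) - 1) * (1 - t) ^ (b:ℝ) + t ^ (a:ℝ) * (-1 * (b:ℝ) * (1 - t) ^ ((b:ℝ) - 1))
    else 0 with hgdef
  have hI1 : IntegrableOn (fun t : ℝ => t ^ ((a:ℝ) - 1) * (1 - t) ^ (b:ℝ)) (Set.Ioo 0 1) := by
    have h := (Literature.Analysis.SpecialFunctions.Selberg.integrableOn_Ioo_rpow_mul_one_sub_rpow_and_integral_eq
      haR (by linarith : (0:ℝ) < b + 1)).1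
    simpa only [add_sub_cancel_right] using h
  have hI2 : IntegrableOn (fun t : ℝ => t ^ (a:ℝ) * (1 - t) ^ ((b:ℝ) - 1)) (Set.Ioo 0 1) := by
    have h := (Literature.Analysis.SpecialFunctions.Selberg.integrableOn_Ioo_rpow_mul_one_sub_rpow_and_integral_eq
      (by linarith : (0:ℝ) < a + 1) hbR).1
    simpa only [add_sub_cancel_right] using h
  have hgi : IntegrableOn g (Set.Icc (0:ℝ) 1) := by
    rw [integrableOn_Icc_iff_integrableOn_Ioo]
    refine IntegrableOn.congr_fun ((hI1.const_mul (a:ℝ)).add (hI2.const_mul (-(b:ℝ))))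
      (fun t ht => ?_) measurableSet_Ioo
    simp only [hgdef, if_pos ht, Pi.add_apply]
    ring
  have hg_sa : IsSemialgebraicFunOn ℚ {x : Fin 1 → ℝ | x 0 ∈ Set.Icc (0:ℝ) 1}
      (fun x : Fin 1 → ℝ => g (x 0)) := by
    refine isSemialgebraicFunOn_Icc_of_Ioo ?_ 0 0 (fun x hx => ?_) (fun x hx => ?_)
    · refine (IsSemialgebraicFunOn.add_holds
        (isSemialgebraicFunOn_const_mul_rpow_mul_rpow a (a - 1) b)
        (isSemialgebraicFunOn_const_mul_rpow_mul_rpow (-b) a (b - 1))).congr fun x hx => ?_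
      have hx' : x 0 ∈ Set.Ioo (0:ℝ) 1 := hx
      simp only [hgdef, if_pos hx', Pi.add_apply, Rat.cast_sub, Rat.cast_one, Rat.cast_neg]; ring
    · have : x 0 ∉ Set.Ioo (0:ℝ) 1 := fun h => by rw [hx] at h; exact lt_irrefl _ h.1
      simp only [hgdef, if_neg this, Rat.cast_zero]
    · have : x 0 ∉ Set.Ioo (0:ℝ) 1 := fun h => by rw [hx] at h; exact lt_irrefl _ h.2
      simp only [hgdef, if_neg this, Rat.cast_zero]
  obtain ⟨D, hDd, hDi⟩ : ∃ D : IntegralRep 1, D.domain = {x : Fin 1 → ℝ | x 0 ∈ Set.Icc (0:ℝ) 1} ∧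
      D.integrand = fun x => g (x 0) :=
    ⟨⟨_, _, isSemialgebraic_setOf_apply_mem_Icc, hg_sa, integrableOn_setOf_apply_mem_iff.2 hgi⟩,
      rfl, rfl⟩
  obtain ⟨Z, hZd, hZi⟩ : ∃ Z : IntegralRep 0, Z.domain = univ ∧ Z.integrand = 0 :=
    exists_zeroRep isSemialgebraic_univ
  have hF_sa : IsSemialgebraicFunOn ℚ {x : Fin 1 → ℝ | x 0 ∈ Set.Icc (0:ℝ) 1}
      (fun z : Fin 1 → ℝ => (z 0) ^ (a:ℝ) * (1 - z 0) ^ (b:ℝ)) := by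
    refine isSemialgebraicFunOn_Icc_of_Ioo ?_ 0 0 (fun x hx => ?_) (fun x hx => ?_)
    · exact (isSemialgebraicFunOn_const_mul_rpow_mul_rpow 1 a b).congr fun x _ => by
        simp only [Rat.cast_one, one_mul]
    · simp only [hx, Real.zero_rpow ha', zero_mul, Rat.cast_zero]
    · simp only [hx, sub_self, Real.zero_rpow hb', mul_zero, Rat.cast_zero]
  have hNL : of D - of Z ∈ newtonLeibnizRel := by
    refine ⟨0, D, Z, fun _ => ((0:ℕ):ℝ), fun _ => ((0:ℕ):ℝ) + 1,
      fun z => (z (Fin.last 0)) ^ (a:ℝ) * (1 - z (Fin.last 0)) ^ (b:ℝ), by rw [hDd]; exact hF_sa,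
      by rw [hZd]; exact isSemialgebraicFunOn_natCast isSemialgebraic_univ 0, ?_,
      fun _ _ => by simp, ?_, ?_, ?_, ?_, rfl⟩
    · rw [hZd]
      exact (isSemialgebraicFunOn_aeval isSemialgebraic_univ
        (((0:ℕ) : MvPolynomial (Fin 0) ℚ) + 1)).congr fun x _ => by simp
    · rw [hDd, hZd]
      ext z; simp only [mem_univ, true_and, mem_setOf_eq, mem_Icc, Nat.cast_zero, zero_add]; rfl
    · intro x _
      simp only [Fin.snoc_last, Nat.cast_zero, zero_add]
      exact ((continuousOn_id.rpow_const fun t _ => Or.inr (by positivity)).mul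
        ((continuousOn_const.sub continuousOn_id).rpow_const fun t _ => Or.inr (by positivity)))
    · intro x _ t ht
      simp only [Nat.cast_zero, zero_add] at ht; simp only [Fin.snoc_last, hDi]; rw [show (0 : Fin 1) = Fin.last 0 from rfl, Fin.snoc_last]
      have hgt : g t = (a:ℝ) * t ^ ((a:ℝ) - 1) * (1 - t) ^ (b:ℝ) +
          t ^ (a:ℝ) * (-1 * (b:ℝ) * (1 - t) ^ ((b:ℝ) - 1)) := by simp only [hgdef, if_pos ht]
      rw [hgt]; exact hasDerivAt_rpow_mul_one_sub_rpow ht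
    · intro x _
      simp only [hZi, Pi.zero_apply, Fin.snoc_last, Nat.cast_zero, zero_add, Real.one_rpow,
        sub_self, Real.zero_rpow hb', Real.zero_rpow ha', mul_zero, zero_mul, sub_zero]
  have hZ_mem : of Z ∈ relations := of_mem_relations_of_eqOn_zero Z (by rw [hZi]; exact fun _ _ => rfl)
  have hD_mem : of D ∈ relations := by
    have := relations.add_mem (newtonLeibnizRel_subset_relations hNL) hZ_mem; rwa [sub_add_cancel] at this
  have hsub : {x : Fin 1 → ℝ | x 0 ∈ Set.Ioo (0:ℝ) 1} ⊆ D.domain := by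
    rw [hDd]; exact fun x hx => ⟨hx.1.le, hx.2.le⟩
  set D₀ := D.restrict _ BallPeeling.isSemialgebraic_posIoo hsub with hD₀
  have hD₀_mem : of D₀ ∈ relations := by
    have h1 := D.of_sub_of_restrict_mem_relations BallPeeling.isSemialgebraic_posIoo hsub
      (by rw [hDd]; exact volume_setOf_Icc_diff_Ioo)
    have := relations.sub_mem hD_mem h1; rwa [sub_sub_cancel] at this
  have hadd : of ρ - of D₀ - of ρ' ∈ integrandAddRel := by
    refine ⟨1, ρ, D₀, ρ', by rw [hρd]; rfl, by rw [hρ'd, hρd], fun x hx => ?_, rfl⟩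
    have hx' : x 0 ∈ Set.Ioo (0:ℝ) 1 := by rw [hρd] at hx; exact hx
    have hxρ' : x ∈ ρ'.domain := by rw [hρ'd]; exact hx'
    rw [Pi.add_apply, hρi hx, hρ'i hxρ']
    simp only [hD₀, IntegralRep.integrand_restrict, hDi, hgdef, if_pos hx']; have ht0 : (x 0) ≠ 0 := hx'.1.ne'; have h1t : (1 - x 0) ≠ 0 := (sub_pos.2 hx'.2).ne'
    have e1 : (x 0) ^ (a:ℝ) = (x 0) ^ ((a:ℝ) - 1) * x 0 := by
      rw [Real.rpow_sub_one ht0, div_mul_cancel₀ _ ht0]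
    have e2 : (1 - x 0) ^ (b:ℝ) = (1 - x 0) ^ ((b:ℝ) - 1) * (1 - x 0) := by
      rw [Real.rpow_sub_one h1t, div_mul_cancel₀ _ h1t]
    rw [e1, e2]; ring
  have := relations.add_mem (integrandAddRel_subset_relations hadd) hD₀_mem; have h' : of ρ - of D₀ - of ρ' + of D₀ = of ρ - of ρ' := by abel
  rw [h'] at this; exact this

/-! ## v7 (lens-5 g22) — THE LEVEL AXIS OF THE BOX LADDER FACTORS: Γ-chains ∧ a transcendence shadow

Fix a predicate `T` on level-`N` exponent patterns `(u,v;u',v')` of length `k`.  The `(k,N)` box splits EXACTLY as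
`BetaWordSectorLevel k N ↔ BoxChain k N T ∧ BoxChain k N ¬T` (`box_iff_boxChain_and_coChain`), and the co-chain is VACUOUS as soon
as the **transcendence shadow** `BoxTranscendence k N T` («off `T` the value ratio `ρ = ∏B/∏B'` is transcendental») holds,
because in a box instance the algebraic factor `q` IS the value ratio (`eq_ratio_of_value_eq`, from the letter values
`bval a b = B(a,b) = Γ(a)Γ(b)/Γ(a+b)`, `bval_eq`, and `word_value`).  Hence `box_iff_boxChain : BoxTranscendence k N T →
(BetaWordSectorLevel k N ↔ BoxChain k N T)`: every box is a CHAIN statement on `T`-patterns (pure KZ-calculus, no number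
theory) plus a TRANSCENDENCE statement off `T` (pure number theory, no calculus).

* **Rung `(k,2)` PROVED for every `k`** (`betaWordSectorLevel_two`), with `T = EqPiCount` (equal number of π-letters `β(½,½)`):
  the level-2 letters are `β(1,1) = 1`, `β(½,1) = β(1,½) = κ(2)` (vendored Literature move `BetaMoves.betaFirst_equivalent_unit_constMul`,
  `β(a,1) ∼ [pt, 1/a]`) and `β(½,½)` of value `π` (`bval_half_half`); a level-2 word is `β(½,½)^j κ(2)^t` in `P`
  (`word_class_two`), the chain part is `κ`-algebra (`boxChain_two`) and the shadow is Lindemann, `π ∉ ℚ̄`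
  (`boxTranscendence_two`, tree theorem `transcendental_pi_holds`).  So `BetaWordSector k ↔ ∀ N ≥ 3, BetaWordSectorLevel k N`.
* **The natural predicate** is Deligne–Koblitz–Ogus type `0` of the Γ-ratio (`SameType N`, via the tree notion
  `IsHodgeTypeGammaMonomial`); at `N = 2` it IS `EqPiCount` (`sameType_two_iff`, proved), so the DKO-shadow at level 2 is a theorem
  (`boxTranscendence_two_sameType`).  For `k = 1` the DKO-shadow at every level is the Wolfart–Wüstholz theorem on pairs of Beta
  values (typed hypothesis `WolfartWustholzPairs`, (cite Waldschmidt2006, p.441 quoting Wolfart–Wüstholz, Math. Ann. 273 (1985))):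
  `betaLinearSector_iff_sameTypeChains : WolfartWustholzPairs → (BetaLinearSector ↔ ∀ N > 0, BoxChain 1 N (SameType N))` —
  crux 3897 has NO transcendence residue beyond a 1985 theorem; for `k ≥ 2` the shadow `RohrlichLangShadow k` (a case of Rohrlich's
  monomial conjecture, (cite Waldschmidt2006, Conjecture 21)) is OPEN at `N = 5` and every `N ≥ 7` (decided at `N ≤ 4`, `N = 6` by
  Lindemann / Chudnovsky) and `betaProductSector_iff_sameTypeChains` isolates it as the number-theoretic residual of crux 3898;
  unconditionally `box_iff_boxChain_and_coChain` splits every box exactly and `sameTypeChains_of_betaWordSector` gives the easy direction.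
-/

namespace BetaMoves

open MeasureTheory Set
open Literature.NumberTheory.Transcendental Literature.NumberTheory.Transcendental.KZ
open Literature.ModelTheory.ExponentialFields (IsSemialgebraic isSemialgebraic_univ
  isSemialgebraic_setOf_eval_pos)
open MvPolynomial (aeval X C)

/-- **`β(a, 1) = [(0,1), t^{a−1}] ∼ [pt, 1/a]`** for a rational `a > 0` and a representation pinned as the Beta representation
`β(a, 1)`: ONE Newton–Leibniz move over the point (rule 3, primitive `F(t) = t^a / a` on the closed slab `[0,1]`), the null
boundary `{0, 1}` (rule 1a) and agreement of the integrands on `(0,1)` (rule 1b).  Value identity `B(a, 1) = 1/a`.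
VENDORED VERBATIM from `Literature/NumberTheory/Transcendental/KZBetaUnitExponent.lean` (`KZ.betaFirst_equivalent_unit_constMul`,
fully proved there; its build cone is stale on the farm at the time of writing, exactly as for `betaTranslation_equivalent` above).
(cite KontsevichZagier2001, §1.2 rule (3)) -/
private theorem betaFirst_equivalent_unit_constMul (a : ℚ) (ha : 0 < a) (β : IntegralRep 1)
    (hβd : β.domain = {t | t 0 ∈ Set.Ioo (0:ℝ) 1})
    (hβi : Set.EqOn β.integrand
      (fun t => (t 0) ^ ((a:ℝ) - 1) * (1 - t 0) ^ (((1:ℚ):ℝ) - 1)) β.domain)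
    (h : IsAlgebraic ℚ ((a : ℝ)⁻¹)) :
    Equivalent β (IntegralRep.unit.constMul ((a : ℝ)⁻¹) h) := by
  have haR : (0:ℝ) < a := by exact_mod_cast ha
  have ha' : (a:ℝ) ≠ 0 := haR.ne'; set g : ℝ → ℝ := fun t => if t ∈ Set.Ioo (0:ℝ) 1 then t ^ ((a:ℝ) - 1) else 0 with hgdef
  have hI : IntegrableOn (fun t : ℝ => t ^ ((a:ℝ) - 1)) (Set.Ioo 0 1) := by
    have h1 := (Literature.Analysis.SpecialFunctions.Selberg.integrableOn_Ioo_rpow_mul_one_sub_rpow_and_integral_eq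
      haR one_pos).1
    refine IntegrableOn.congr_fun h1 (fun t _ => ?_) measurableSet_Ioo
    simp
  have hgi : IntegrableOn g (Set.Icc (0:ℝ) 1) := by
    rw [integrableOn_Icc_iff_integrableOn_Ioo]; exact IntegrableOn.congr_fun hI (fun t ht => by simp only [hgdef, if_pos ht]) measurableSet_Ioo
  have hg_sa : IsSemialgebraicFunOn ℚ {x : Fin 1 → ℝ | x 0 ∈ Set.Icc (0:ℝ) 1}
      (fun x : Fin 1 → ℝ => g (x 0)) := by
    refine isSemialgebraicFunOn_Icc_of_Ioo ?_ 0 0 (fun x hx => ?_) (fun x hx => ?_)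
    · refine (isSemialgebraicFunOn_const_mul_rpow_mul_rpow 1 (a - 1) 0).congr fun x hx => ?_
      have hx' : x 0 ∈ Set.Ioo (0:ℝ) 1 := hx
      simp only [hgdef, if_pos hx', Rat.cast_one, one_mul, Rat.cast_sub, Rat.cast_zero,
        Real.rpow_zero, mul_one]
    · have : x 0 ∉ Set.Ioo (0:ℝ) 1 := fun h => by rw [hx] at h; exact lt_irrefl _ h.1
      simp only [hgdef, if_neg this, Rat.cast_zero]
    · have : x 0 ∉ Set.Ioo (0:ℝ) 1 := fun h => by rw [hx] at h; exact lt_irrefl _ h.2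
      simp only [hgdef, if_neg this, Rat.cast_zero]
  obtain ⟨D, hDd, hDi⟩ : ∃ D : IntegralRep 1, D.domain = {x : Fin 1 → ℝ | x 0 ∈ Set.Icc (0:ℝ) 1} ∧
      D.integrand = fun x => g (x 0) :=
    ⟨⟨_, _, isSemialgebraic_setOf_apply_mem_Icc, hg_sa, integrableOn_setOf_apply_mem_iff.2 hgi⟩,
      rfl, rfl⟩
  have hF_sa : IsSemialgebraicFunOn ℚ {x : Fin 1 → ℝ | x 0 ∈ Set.Icc (0:ℝ) 1}
      (fun z : Fin 1 → ℝ => (a:ℝ)⁻¹ * (z 0) ^ (a:ℝ)) := by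
    refine isSemialgebraicFunOn_Icc_of_Ioo ?_ 0 a⁻¹ (fun x hx => ?_) (fun x hx => ?_)
    · refine (isSemialgebraicFunOn_const_mul_rpow_mul_rpow a⁻¹ a 0).congr fun x _ => ?_
      simp only [Rat.cast_inv, Rat.cast_zero, Real.rpow_zero, mul_one]
    · simp only [hx, Real.zero_rpow ha', mul_zero, Rat.cast_zero]
    · simp only [hx, Real.one_rpow, mul_one, Rat.cast_inv]
  set U := IntegralRep.unit.constMul ((a : ℝ)⁻¹) h with hU
  have hUd : U.domain = univ := by rw [hU, IntegralRep.domain_constMul, IntegralRep.unit_domain]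
  have hNL : of D - of U ∈ newtonLeibnizRel := by
    refine ⟨0, D, U, fun _ => ((0:ℕ):ℝ), fun _ => ((0:ℕ):ℝ) + 1,
      fun z => (a:ℝ)⁻¹ * (z (Fin.last 0)) ^ (a:ℝ), by rw [hDd]; exact hF_sa,
      by rw [hUd]; exact isSemialgebraicFunOn_natCast isSemialgebraic_univ 0, ?_,
      fun _ _ => by simp, ?_, ?_, ?_, ?_, rfl⟩
    · rw [hUd]
      exact (isSemialgebraicFunOn_aeval isSemialgebraic_univ
        (((0:ℕ) : MvPolynomial (Fin 0) ℚ) + 1)).congr fun x _ => by simp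
    · rw [hDd, hUd]
      ext z; simp only [mem_univ, true_and, mem_setOf_eq, mem_Icc, Nat.cast_zero, zero_add]; rfl
    · intro x _
      simp only [Fin.snoc_last, Nat.cast_zero, zero_add]; exact continuousOn_const.mul (continuousOn_id.rpow_const fun t _ => Or.inr haR.le)
    · intro x _ t ht
      simp only [Nat.cast_zero, zero_add] at ht
      simp only [Fin.snoc_last, hDi]; rw [show (0 : Fin 1) = Fin.last 0 from rfl, Fin.snoc_last]; have hgt : g t = t ^ ((a:ℝ) - 1) := by simp only [hgdef, if_pos ht]
      rw [hgt]
      have hd : HasDerivAt (fun s : ℝ => (a:ℝ)⁻¹ * s ^ (a:ℝ)) (t ^ ((a:ℝ) - 1)) t := by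
        have h0 := (Real.hasDerivAt_rpow_const (p := (a:ℝ)) (Or.inl ht.1.ne')).const_mul (a:ℝ)⁻¹
        have heq : (a:ℝ)⁻¹ * ((a:ℝ) * t ^ ((a:ℝ) - 1)) = t ^ ((a:ℝ) - 1) := by
          rw [← mul_assoc, inv_mul_cancel₀ ha', one_mul]
        rwa [heq] at h0
      exact hd
    · intro x _
      simp only [hU, IntegralRep.integrand_constMul, IntegralRep.unit_integrand, Fin.snoc_last,
        Nat.cast_zero, zero_add, Real.one_rpow, Real.zero_rpow ha', mul_one, mul_zero, sub_zero]
  have hD_mem : of D - of U ∈ relations := newtonLeibnizRel_subset_relations hNL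
  have hsub : {x : Fin 1 → ℝ | x 0 ∈ Set.Ioo (0:ℝ) 1} ⊆ D.domain := by
    rw [hDd]; exact fun x hx => ⟨hx.1.le, hx.2.le⟩
  set D₀ := D.restrict _ BallPeeling.isSemialgebraic_posIoo hsub with hD₀
  have h1 : of D - of D₀ ∈ relations :=
    D.of_sub_of_restrict_mem_relations BallPeeling.isSemialgebraic_posIoo hsub
      (by rw [hDd]; exact volume_setOf_Icc_diff_Ioo)
  have h2 : of β - of D₀ ∈ relations := by
    refine of_sub_of_mem_relations_of_eqOn (by rw [hβd]; rfl) fun x hx => ?_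
    have hx' : x 0 ∈ Set.Ioo (0:ℝ) 1 := by rw [hβd] at hx; exact hx
    rw [hβi hx]
    simp only [hD₀, IntegralRep.integrand_restrict, hDi, hgdef, if_pos hx', Rat.cast_one, sub_self,
      Real.rpow_zero, mul_one]
  have := relations.add_mem (relations.sub_mem h2 h1) hD_mem; have h' : of β - of D₀ - (of D - of D₀) + (of D - of U) = of β - of U := by abel
  rw [h'] at this; exact this

end BetaMoves

/-- Rational numbers are real algebraic. [bookkeeping] -/
private theorem isAlgebraic_ratCast (x : ℚ) : IsAlgebraic ℚ (x : ℝ) := by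
  have h := isAlgebraic_algebraMap (R := ℚ) (A := ℝ) x; rwa [eq_ratCast] at h

/-- **`β(a,1) = κ(1/a)` in `P`** for rational `a > 0` (vendored Literature move `BetaMoves.betaFirst_equivalent_unit_constMul`).
(cite KontsevichZagier2001, §1.2 rule (3)) -/
theorem bcl_rat_one (a : ℚ) (ha : 0 < a) :
    bcl a 1 = kc ((a:ℝ)⁻¹) (isAlgebraic_ratCast a).inv := by
  rw [bcl_eq ha one_pos]
  exact (BetaMoves.betaFirst_equivalent_unit_constMul a ha (bRep a 1 ha one_pos) (bRep_domain a 1 ha one_pos)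
    (bRep_integrand a 1 ha one_pos) _).toFormalPeriod_eq

end Summit.KontsevichZagierPeriods.FermatIsogeny.DeepTargets
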